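import Literature.NumberTheory.IwasawaTheory.ImaginaryQuadraticTwoTowerGenusRank
import Literature.NumberTheory.EllipticCurves.FineSelmerClassGroupPRankBoundedProofs
import HarnessLib

/-!
# Genus theory inside the cyclotomic `ℤ₂`-tower of an imaginary quadratic field, II: EVERY cyclotomic `ℤ₂`-extension, and the
# `d`-keyed forms for `K ∋ √−d`, `d ≡ 3 (mod 4)` squarefree — `rank₂ Cl(K_n)` is ODD iff `d ≡ 7 (mod 8)`, EVEN iff `d ≡ 3 (mod 8)` (`n ≥ 1`)

Topic `NumberTheory/IwasawaTheory` (namespace = path).  THEOREM-ONLY file (no definition, no named fact, no `sorry`), written by the prover seat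
`bsd-line-att-p3` g30 (cell `bsd-f1-sign2`; `--supports` stmt-BirchSwinnertonDyer-22298; closes nothing).  Sequel of
`ImaginaryQuadraticTwoTowerGenusRank.lean` (there: `rank₂ Cl((K·ℚ_∞)_n) = t_n − 1` and the χ₈ parity law for the RESTRICTION to `Γ_K` of a cyclotomic
`ℤ₂`-extension of `ℚ`).  Here:

* `classGroupPRank_imaginaryQuadratic_cyclotomic_two_eq`, `classGroupPRank_cyclotomic_two_succ_mod_two_eq`, `odd_classGroupPRank_cyclotomic_two_iff`,
  `even_classGroupPRank_cyclotomic_two_iff`, `classGroupPRank_cyclotomic_two_zero_eq` — the same statements for EVERY cyclotomic `ℤ₂`-extension `κK`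
  of `K` (two cyclotomic `ℤ₂`-extensions have the same layers, tree `classGroupPRank_eq_of_isCyclotomic`; the primes are counted in the layers `ℚ_n` of
  `CyclotomicZp.zpExtension 2`).
* `discr_eq_neg_of_sq_eq_neg` (`d_K = −d`), `isImaginaryQuadratic_and_natAbs_discr_eq_of_sq_eq_neg`, and the `d`-keyed laws
  **`odd_classGroupPRank_cyclotomic_two_iff_of_sq_eq_neg`** (`K ∋ η`, `η² = −d`, `d ≡ 3 (mod 4)` squarefree, `[K:ℚ] = 2`, `n ≥ 1`:
  **`rank₂ Cl(K_n)` odd iff `d ≡ 7 (mod 8)`, even iff `d ≡ 3 (mod 8)`**) and `classGroupPRank_cyclotomic_two_eq_of_sq_eq_neg`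
  (`rank₂ Cl(K_n) = Σ_{ℓ ∣ d} g_n(ℓ) − 1`, `rank₂ Cl(K) = ω(d) − 1`).

HONEST SCOPE as in the parent file (`d_K` odd only; the exact `g_n(ℓ)` is not computed).  Nothing here is specific to any summit; BSD is not proved by
any of this.

## References
* B. Ferrero, Amer. J. Math. 102 (1980) 447–459, §2. [Ferrero1980AJM]
* Y. Kida, Tôhoku Math. J. 31 (1979) 91–96, Thm. 1. [Kida1979Tohoku]
* R. Okazaki, Acta Arith. 92 (2000), §3 Lemma 17. [Okazaki2000]
* L. C. Washington, *Introduction to Cyclotomic Fields* (1997), §13.1, Thm. 10.8. [Washington1997]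
-/

set_option autoImplicit false

noncomputable section

open scoped NumberField
open NumberField IsDedekindDomain Field IntermediateField Module Ideal

namespace Literature.NumberTheory.IwasawaTheory

open Literature.NumberTheory.EllipticCurves Literature.NumberTheory.EllipticCurves.ZpExtension
  Literature.NumberTheory.GaloisRepresentations Literature.NumberTheory.NumberFields
  Literature.NumberTheory.QuadraticFields.Quadratic

section AnyCyclotomic

variable (K : Type) [Field K] [NumberField K] (hK : IsImaginaryQuadratic K)

include hK in
/-- **`rank₂ Cl(K_n) = t_n − 1` (and `1 ≤ t_n`) for EVERY cyclotomic `ℤ₂`-extension `κK` of the imaginary quadratic `K` with odd `d_K`**, the primes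
being counted in the layers `ℚ_n` of the canonical cyclotomic `ℤ₂`-extension of `ℚ` (`CyclotomicZp.zpExtension 2`): two cyclotomic `ℤ₂`-extensions of `K`
have the same layers (`classGroupPRank_eq_of_isCyclotomic`), and `κK` may be taken to be the restriction of `ℚ`'s. [cite: Ferrero1980AJM, §2]
[cite: Kida1979Tohoku, Thm. 1 (proof)] [cite: Washington1997, §13.1] -/
theorem classGroupPRank_imaginaryQuadratic_cyclotomic_two_eq (hd : Odd (NumberField.discr K).natAbs)
    (κK : ZpExtension K 2) (hκK : κK.IsCyclotomic) (n : ℕ) :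
    classGroupPRank κK n =
        (∑ ℓ ∈ (NumberField.discr K).natAbs.primeFactors,
          ((Ideal.span {(ℓ : ℤ)}).primesOver (𝓞 ↥((CyclotomicZp.zpExtension 2).layer n))).ncard) - 1 ∧
      1 ≤ ∑ ℓ ∈ (NumberField.discr K).natAbs.primeFactors,
        ((Ideal.span {(ℓ : ℤ)}).primesOver (𝓞 ↥((CyclotomicZp.zpExtension 2).layer n))).ncard := by
  have hcyc := CyclotomicZp.isCyclotomic_zpExtension 2
  have hsurj := surjective_comp_absGaloisRestrict_imaginaryQuadratic_two hcyc K hK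
  rw [CoatesSujatha2005.classGroupPRank_eq_of_isCyclotomic κK _ hκK (isCyclotomic_restrict (CyclotomicZp.zpExtension 2) hcyc K hsurj)]
  exact classGroupPRank_restrict_imaginaryQuadratic_two_eq hcyc K hK hd n

include hK in
/-- **THE χ₈ PARITY LAW for every cyclotomic `ℤ₂`-extension of `K`** (`d_K` odd, `n ≥ 1`):
`rank₂ Cl(K_n) + 1 ≡ #{ℓ ∣ d_K : ℓ ≡ 3, 5 (mod 8)} (mod 2)`. [cite: Ferrero1980AJM, §2] [cite: Washington1997, §13.1 and Thm. 10.8] -/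
theorem classGroupPRank_cyclotomic_two_succ_mod_two_eq (hd : Odd (NumberField.discr K).natAbs)
    (κK : ZpExtension K 2) (hκK : κK.IsCyclotomic) {n : ℕ} (hn : 1 ≤ n) :
    (classGroupPRank κK n + 1) % 2 = ((NumberField.discr K).natAbs.primeFactors.filter (fun ℓ => ℓ % 8 = 3 ∨ ℓ % 8 = 5)).card % 2 := by
  have hcyc := CyclotomicZp.isCyclotomic_zpExtension 2
  have hsurj := surjective_comp_absGaloisRestrict_imaginaryQuadratic_two hcyc K hK
  rw [CoatesSujatha2005.classGroupPRank_eq_of_isCyclotomic κK _ hκK (isCyclotomic_restrict (CyclotomicZp.zpExtension 2) hcyc K hsurj)]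
  exact classGroupPRank_restrict_succ_mod_two_eq hcyc K hK hd hn

include hK in
/-- **`rank₂ Cl(K_n)` is ODD for every `n ≥ 1` iff `|d_K| ≡ ±1 (mod 8)`**, for every cyclotomic `ℤ₂`-extension of the imaginary quadratic `K` with odd
`d_K`. [cite: Ferrero1980AJM, §2] [cite: Washington1997, Thm. 10.8] -/
theorem odd_classGroupPRank_cyclotomic_two_iff (hd : Odd (NumberField.discr K).natAbs)
    (κK : ZpExtension K 2) (hκK : κK.IsCyclotomic) {n : ℕ} (hn : 1 ≤ n) :
    Odd (classGroupPRank κK n) ↔ ((NumberField.discr K).natAbs % 8 = 1 ∨ (NumberField.discr K).natAbs % 8 = 7) := by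
  have hcyc := CyclotomicZp.isCyclotomic_zpExtension 2
  have hsurj := surjective_comp_absGaloisRestrict_imaginaryQuadratic_two hcyc K hK
  rw [CoatesSujatha2005.classGroupPRank_eq_of_isCyclotomic κK _ hκK (isCyclotomic_restrict (CyclotomicZp.zpExtension 2) hcyc K hsurj)]
  exact odd_classGroupPRank_restrict_iff hcyc K hK hd hn

include hK in
/-- **`rank₂ Cl(K_n)` is EVEN for every `n ≥ 1` iff `|d_K| ≡ ±3 (mod 8)`** (every cyclotomic `ℤ₂`-extension; `d_K` odd). [cite: Ferrero1980AJM, §2]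
[cite: Washington1997, Thm. 10.8] -/
theorem even_classGroupPRank_cyclotomic_two_iff (hd : Odd (NumberField.discr K).natAbs)
    (κK : ZpExtension K 2) (hκK : κK.IsCyclotomic) {n : ℕ} (hn : 1 ≤ n) :
    Even (classGroupPRank κK n) ↔ ((NumberField.discr K).natAbs % 8 = 3 ∨ (NumberField.discr K).natAbs % 8 = 5) := by
  have hcyc := CyclotomicZp.isCyclotomic_zpExtension 2
  have hsurj := surjective_comp_absGaloisRestrict_imaginaryQuadratic_two hcyc K hK
  rw [CoatesSujatha2005.classGroupPRank_eq_of_isCyclotomic κK _ hκK (isCyclotomic_restrict (CyclotomicZp.zpExtension 2) hcyc K hsurj)]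
  exact even_classGroupPRank_restrict_iff hcyc K hK hd hn

include hK in
/-- **Layer `0` (Gauss), every cyclotomic `κK`: `rank₂ Cl(K) = ω(d_K) − 1`** (`d_K` odd). [cite: Okazaki2000, §3 Lemma 17] [cite: Washington1997, §13.1] -/
theorem classGroupPRank_cyclotomic_two_zero_eq (hd : Odd (NumberField.discr K).natAbs)
    (κK : ZpExtension K 2) (hκK : κK.IsCyclotomic) :
    classGroupPRank κK 0 = (NumberField.discr K).natAbs.primeFactors.card - 1 := by
  have hcyc := CyclotomicZp.isCyclotomic_zpExtension 2
  have hsurj := surjective_comp_absGaloisRestrict_imaginaryQuadratic_two hcyc K hK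
  rw [CoatesSujatha2005.classGroupPRank_eq_of_isCyclotomic κK _ hκK (isCyclotomic_restrict (CyclotomicZp.zpExtension 2) hcyc K hsurj)]
  exact classGroupPRank_restrict_zero_eq hcyc K hK hd

/-- **`d_K = −d` for a quadratic `K ∋ η` with `η² = −d`, `d ≡ 3 (mod 4)` squarefree** (`−d ≡ 1 (mod 4)` is a fundamental discriminant).
[cite: Washington1997, §13.1] [cite: Okazaki2000, §3 (quadratic discriminants)] -/
theorem discr_eq_neg_of_sq_eq_neg (hK2 : Module.finrank ℚ K = 2) {d : ℕ} (hsf : Squarefree d) (hd4 : d % 4 = 3)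
    (hη : ∃ η : K, η ^ 2 = -((d : ℕ) : K)) : NumberField.discr K = -(d : ℤ) := by
  obtain ⟨η, hη⟩ := hη
  have hsq : η ^ 2 = ((-(d : ℤ) : ℤ) : K) := by rw [hη]; push_cast; ring
  refine discr_eq_of_sq_eq_intCast hK2 hsq (by omega) ?_ (by omega)
  exact Int.squarefree_natAbs.mp (by rw [Int.natAbs_neg, Int.natAbs_natCast]; exact hsf)

/-- `K ∋ η` with `η² = −d` (`d ≡ 3 (mod 4)` squarefree, `[K : ℚ] = 2`) is imaginary quadratic with `|d_K| = d` odd. [cite: Washington1997, §13.1] -/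
theorem isImaginaryQuadratic_and_natAbs_discr_eq_of_sq_eq_neg (hK2 : Module.finrank ℚ K = 2) {d : ℕ} (hsf : Squarefree d) (hd4 : d % 4 = 3)
    (hη : ∃ η : K, η ^ 2 = -((d : ℕ) : K)) :
    IsImaginaryQuadratic K ∧ (NumberField.discr K).natAbs = d ∧ Odd (NumberField.discr K).natAbs := by
  have hdisc := discr_eq_neg_of_sq_eq_neg K hK2 hsf hd4 hη
  obtain ⟨η, hη'⟩ := hη
  have hd0 : 0 < d := by omega
  have hneg : -(d : ℚ) < 0 := by
    have : (0 : ℚ) < d := by exact_mod_cast hd0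
    linarith
  have hIQ : IsImaginaryQuadratic K :=
    IsImaginaryQuadratic.of_sq_eq hK2 (θ := η) (c := -(d : ℚ)) (by rw [hη', map_neg, map_natCast]) hneg
  have hnat : (NumberField.discr K).natAbs = d := by rw [hdisc, Int.natAbs_neg, Int.natAbs_natCast]
  exact ⟨hIQ, hnat, hnat ▸ Nat.odd_iff.mpr (by omega)⟩

/-- **The `d`-keyed parity law: `K ∋ √−d`, `d ≡ 3 (mod 4)` squarefree, `κK` any cyclotomic `ℤ₂`-extension, `n ≥ 1`:
`rank₂ Cl(K_n)` is ODD iff `d ≡ 7 (mod 8)` and EVEN iff `d ≡ 3 (mod 8)`.** [cite: Ferrero1980AJM, §2] [cite: Washington1997, Thm. 10.8] -/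
theorem odd_classGroupPRank_cyclotomic_two_iff_of_sq_eq_neg (hK2 : Module.finrank ℚ K = 2) {d : ℕ} (hsf : Squarefree d) (hd4 : d % 4 = 3)
    (hη : ∃ η : K, η ^ 2 = -((d : ℕ) : K)) (κK : ZpExtension K 2) (hκK : κK.IsCyclotomic) {n : ℕ} (hn : 1 ≤ n) :
    (Odd (classGroupPRank κK n) ↔ d % 8 = 7) ∧ (Even (classGroupPRank κK n) ↔ d % 8 = 3) := by
  obtain ⟨hIQ, hnat, hodd⟩ := isImaginaryQuadratic_and_natAbs_discr_eq_of_sq_eq_neg K hK2 hsf hd4 hη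
  have h1 := odd_classGroupPRank_cyclotomic_two_iff K hIQ hodd κK hκK hn
  have h2 := even_classGroupPRank_cyclotomic_two_iff K hIQ hodd κK hκK hn
  rw [hnat] at h1 h2
  constructor
  · rw [h1]; omega
  · rw [h2]; omega

/-- **The `d`-keyed genus count: `rank₂ Cl(K_n) = (Σ_{ℓ ∣ d} g_n(ℓ)) − 1` with `1 ≤ Σ`** (`K ∋ √−d`, `d ≡ 3 (mod 4)` squarefree, any cyclotomic `κK`, every `n`);
at `n = 0`: `rank₂ Cl(K) = ω(d) − 1`. [cite: Ferrero1980AJM, §2] [cite: Okazaki2000, §3 Lemma 17] -/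
theorem classGroupPRank_cyclotomic_two_eq_of_sq_eq_neg (hK2 : Module.finrank ℚ K = 2) {d : ℕ} (hsf : Squarefree d) (hd4 : d % 4 = 3)
    (hη : ∃ η : K, η ^ 2 = -((d : ℕ) : K)) (κK : ZpExtension K 2) (hκK : κK.IsCyclotomic) (n : ℕ) :
    (classGroupPRank κK n =
        (∑ ℓ ∈ d.primeFactors, ((Ideal.span {(ℓ : ℤ)}).primesOver (𝓞 ↥((CyclotomicZp.zpExtension 2).layer n))).ncard) - 1 ∧
      1 ≤ ∑ ℓ ∈ d.primeFactors, ((Ideal.span {(ℓ : ℤ)}).primesOver (𝓞 ↥((CyclotomicZp.zpExtension 2).layer n))).ncard) ∧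
      classGroupPRank κK 0 = d.primeFactors.card - 1 := by
  obtain ⟨hIQ, hnat, hodd⟩ := isImaginaryQuadratic_and_natAbs_discr_eq_of_sq_eq_neg K hK2 hsf hd4 hη
  have h1 := classGroupPRank_imaginaryQuadratic_cyclotomic_two_eq K hIQ hodd κK hκK n
  have h0 := classGroupPRank_cyclotomic_two_zero_eq K hIQ hodd κK hκK
  rw [hnat] at h1 h0
  exact ⟨h1, h0⟩

end AnyCyclotomic

end Literature.NumberTheory.IwasawaTheory

end
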